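/-
Copyright (c) 2026 the pub-hodgecm-mathlib formalisation cell (harness21).  Prover seat hodgecm-mathlib-F0P3a-p04 (g19): road «S3-ram» (LEAD F0P3a-plan (g13); junction
pen F0P3a-p01 (g17); S45 supplier `row_S45_hyperbolic`, organ (V1) of HYP-PLAN v1; owner F0P3a-p06 (g15)); 2026-09-02.
-/
import Literature.NumberTheory.Automorphic.UnitaryLatticeTreeIsocelesRegionLinesRamified        -- ★ p847884 (F0P3-p03): §7 value shape (brings ★ criterion p847753, ★ distance p847820)
import Literature.NumberTheory.Automorphic.UnitaryLatticeTreeResidualTokens                     -- ★ p847953 (F0P3a-p05): `residue_ne_zero_of_v_eq_one`; brings ★ G3⁗ `exists_integer_eq_test_and_residue_eq`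
import Literature.NumberTheory.Automorphic.UnitaryLatticeTreeApartment                         -- ★ `pairing_mulVec_mulVec_of_mem_unitary`
import HarnessLib

/-!
# The lattice graph of a hermitian space — THE ISOCELES REGION: THE RESIDUAL VALUE FORM AT A REGION VERTEX IN AN ADAPTED UNITARY FRAME (tame-ramified place)
# (Bruhat–Tits 1972 §10; Kottwitz 1986 §3; Rogawski 1990 §4.9)

Topic `NumberTheory/Automorphic`; namespace `Literature.NumberTheory.Automorphic.UnitaryLatticeTree`.  THEOREMS ONLY (no definition, no instance, no notation, no named fact,
no `sorry`); kernel lane `--supports stmt-HodgeConjecture-24833`.  Cell `pub/hodgecm-mathlib` (D-0151), crux H413; road «S3-ram» (Literature seeding, count-neutral); junction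
(J★), ISOCELES wave, supplier `row_S45_hyperbolic` (S45 v4, hand F0P3a-p02 (g17) ∕ p04 (g19)), organ **(V1) of HYP-PLAN v1** (`F0/P3a/F0P3a-p04/g19/hyp/HYP-PLAN.v1…md`).

THE SETTING (★ `…IsocelesRegionCriterionRamified`): `γ = A·diag(s)·A⁻¹`, Gram `κ₀·diag(d)` (`κ₀ = (−det diag d)⁻¹`, `σ d = d`, `|d| = 1`), isolated index `i₀`, close pair
`{j, k}`, `|s_{i₀} − s_m| = |ϖ|^{d₀}`, `|s_j − s_k| = |ϖ|^{d₀+2s'}`, `1 ≤ s'`; `u_m := A e_m`.  A REGION VERTEX `v = u·r₀` (`u` unitary, `(γ − 1)v ≤ ϖ^{d₀}v`) in a frame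
ADAPTED to an in-region child `u·N₁` (`|⟨u_{i₀}, u e₀⟩| < 1`, `|⟨ϖ^{s'}u_k, u e₀⟩| < 1` — by the ★ LINE TEST this says the far side of the child `u·N₁` lies in the region: the
INWARD child of `v ≠ r₀`, or a null root line at `r₀`).  The consumer (★ G3⁗ bridge `ncard_neighborSet_pred_eq_natCard (u) (M := u⁻¹γu − 1) (Y₀)`) reads the children of `v`
through the RESIDUAL TEST FORM `x̄ ↦ ᵗx̄ (J̄₀·Ȳ) x̄`, `Ȳ = residue(Y₀)`, `Y₀ = ϖ^{−d₀}(u⁻¹γu − 1) ∈ M₃(𝒪)`.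

THE RESULT **`isotropicValue_eq_vertexShape_of_region`**: there are `c t l ∈ 𝓀`, `c ≠ 0`, with
  `ᵗx̄ (J̄₀Ȳ) x̄ = c·(x̄₁ + t·x̄₂)² + l·x̄₂²` for every residually isotropic `x̄` (`2x̄₀x̄₂ + x̄₁² = 0`),
exactly the datum of the ★ vertex-frame census (`Rogawski1990/DepthZeroKappaTransferTypeOneRamifiedAxisVertexFrameCensus`, F0P3a-p02), together with
  `l = 0 ↔ ϖ^{s'−1}u_k ∈ v` (END vertices are those with `l ≠ 0`; by ★ DEPTH = CONTENT `dist(r₀, v) ≤ 2s'−2 ↔ ϖ^{s'−1}u_k ∈ v`),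
and the two CLASS PINS consumed by S45's `lock` ∕ `BIG` tokens: `c ∈ C̄·𝓀ײ` for `C = (ϖ^{d₀})⁻¹(s_{i₀} − s_j)·d_{i₀}·κ₀`, and at an END vertex `−l·c ∈ B̄·𝓀ײ` for
`B = (−1)^{s'+1}·(ϖ^{d₀})⁻¹(s_{i₀} − s_j)·(ϖ^{d₀+2s'})⁻¹(s_k − s_j)·d_{i₀}d_k`.
PROOF: ★ p03 §7 `pairing_sub_one_mulVec_sub_eq_norm_add_norm` at the vector `u x` (the Gram datum `hdA` only enters through `A`): `⟨ux,(γ−1)ux⟩ = (s_j−1)⟨x,x⟩ +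
α·N⟨w,x⟩ + β·N⟨m,x⟩` with `w = u⁻¹u_{i₀}`, `m = u⁻¹ϖ^{s'}u_k` INTEGRAL (★ REGION CRITERION), `|α| = |β| = |ϖ|^{d₀}`; residually (`σ̄ = id`) the first term dies on
isotropic `x̄`, `w̄` is anisotropic with `w̄₂ = 0` (adaptation) so `⟨w̄, x̄⟩ = w̄₁(x̄₁ + (w̄₀∕w̄₁)x̄₂)`, and `m̄` is isotropic with `m̄₂ = 0`, whence `m̄₁ = 0` and `⟨m̄, x̄⟩ = m̄₀x̄₂`.

HONEST LABEL: HC_CM is proved only modulo the 2 remaining named inputs (hLiu418 24832, h413 24833) until rung 0 closes; nothing printed is asserted here (module algebra over a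
valuation ring and residues); «S3-ram» has no books consequence.

## References
* [BruhatTits1972] F. Bruhat, J. Tits, *Groupes réductifs sur un corps local I*, Publ. Math. IHÉS 41 (1972), §10 (the star of a vertex = the residual building).
* [Kottwitz1986] R. E. Kottwitz, *Base change for unit elements of Hecke algebras*, Compositio Math. 60 (1986), §3 (fixed lattices of a torus element, residual data).
* [Rogawski1990] J. D. Rogawski, *Automorphic Representations of Unitary Groups in Three Variables*, Ann. of Math. Stud. 123 (1990), §4.9 pp. 54–56.
* [Tits1979] J. Tits, *Reductive groups over local fields*, PSPM 33.1 (1979), §3.5 (reduction mod `𝔭`).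
-/

set_option autoImplicit false

noncomputable section

open scoped Valued WithZero Matrix MatrixGroups

namespace Literature.NumberTheory.Automorphic.UnitaryLatticeTree

open Literature.NumberTheory.Automorphic Literature.NumberTheory.Automorphic.HermitianLattice

variable {K : Type*} [Field K] [Valued K ℤᵐ⁰] {σ : K →+* K} {ϖ : K}

/-! ## §1 Residues of pairings of integral vectors -/

/-- The pairing of two INTEGRAL vectors for `J₀ = antidiag(1,1,1)` is an integer whose residue is `w̄₀x̄₂ + w̄₁x̄₁ + w̄₂x̄₀` (`σ̄ = id` at a tame-ramified place).
[cite: Tits1979, §3.5] [cite: BruhatTits1972, §10] -/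
theorem exists_integer_pairing_and_residue_eq (hvσ : ∀ a, Valued.v (σ a) = Valued.v a) (hres : ∀ x : K, Valued.v x ≤ 1 → Valued.v (σ x - x) < 1)
    (w₀ x₀ : Fin 3 → 𝒪[K]) :
    ∃ p : 𝒪[K], (p : K) = pairing σ ((StdForm.antidiagonal 3).over K) (fun i => (w₀ i : K)) (fun i => (x₀ i : K)) ∧
      IsLocalRing.residue 𝒪[K] p = IsLocalRing.residue 𝒪[K] (w₀ 0) * IsLocalRing.residue 𝒪[K] (x₀ 2) + IsLocalRing.residue 𝒪[K] (w₀ 1) * IsLocalRing.residue 𝒪[K] (x₀ 1) +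
        IsLocalRing.residue 𝒪[K] (w₀ 2) * IsLocalRing.residue 𝒪[K] (x₀ 0) := by
  refine ⟨∑ i, (⟨σ (w₀ i : K), map_coe_mem_integer hvσ (w₀ i)⟩ : 𝒪[K]) * x₀ (Fin.rev i), ?_, ?_⟩
  · rw [pairing_antidiagonal, B₀_apply]
    push_cast
    rfl
  · rw [map_sum, Fin.sum_univ_three]
    simp only [map_mul, residue_map_sigma_eq hvσ hres]
    rfl

/-! ## §2 The residual value form at a region vertex in an adapted frame -/

set_option maxHeartbeats 400000 in
/-- **(V1) THE RESIDUAL VALUE FORM AT A REGION VERTEX IN AN ADAPTED UNITARY FRAME.**  `v = u·r₀` a region vertex (`(γ−1)v ≤ ϖ^{d₀}v`), the frame adapted to an in-region child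
(`|⟨u_{i₀}, ue₀⟩| < 1`, `|⟨ϖ^{s'}u_k, ue₀⟩| < 1`), `Y₀ = ϖ^{−d₀}(u⁻¹γu − 1)` entrywise in `𝒪`.  Then for some `c t l ∈ 𝓀` with `c ≠ 0`: the residual test form is
`ᵗx̄(J̄₀Ȳ)x̄ = c(x̄₁ + t x̄₂)² + l x̄₂²` on residually isotropic `x̄`; `l = 0 ↔ ϖ^{s'−1}u_k ∈ v`; `c ∈ C̄·𝓀ײ` (`C` = S45's lock constant); and if `l ≠ 0` then
`−l·c ∈ B̄·𝓀ײ` (`B` = S45's BIG constant). [cite: Kottwitz1986, §3] [cite: BruhatTits1972, §10] [cite: Rogawski1990, §4.9 pp. 54–56] -/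
theorem isotropicValue_eq_vertexShape_of_region (hσ : ∀ x, σ (σ x) = x) (hvσ : ∀ a, Valued.v (σ a) = Valued.v a) (hσϖ : σ ϖ = -ϖ)
    (hϖ : Valued.v ϖ = WithZero.exp (-1 : ℤ)) (hres : ∀ x : K, Valued.v x ≤ 1 → Valued.v (σ x - x) < 1)
    {γ : unitaryGroupOfForm σ ((StdForm.antidiagonal 3).over K)}
    (d : Fin 3 → K) (hd : ∀ i, Valued.v (d i) = 1) (hdσ : ∀ i, σ (d i) = d i)
    (A : GL (Fin 3) K) (hdA : Matrix.diagonal d = (-(Matrix.diagonal d).det) • formCongr σ A ((StdForm.antidiagonal 3).over K))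
    (s : Fin 3 → K) (hγA : ((γ : GL (Fin 3) K) : Matrix (Fin 3) (Fin 3) K) = (A : Matrix (Fin 3) (Fin 3) K) * Matrix.diagonal s * ((A⁻¹ : GL (Fin 3) K) : Matrix (Fin 3) (Fin 3) K))
    (i₀ : Fin 3) {d₀ : ℕ} (he : ∀ i, Valued.v (s i - 1) ≤ Valued.v ϖ ^ d₀) (hiso : ∀ m, m ≠ i₀ → Valued.v (s i₀ - s m) = Valued.v ϖ ^ d₀)
    {s' : ℕ} (hs' : 1 ≤ s') (hgap : ∀ j k, j ≠ i₀ → k ≠ i₀ → j ≠ k → Valued.v (s j - s k) = Valued.v ϖ ^ (d₀ + 2 * s'))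
    {j k : Fin 3} (hj : j ≠ i₀) (hk : k ≠ i₀) (hjk : j ≠ k)
    (u : unitaryGroupOfForm σ ((StdForm.antidiagonal 3).over K)) {v : {M : Submodule 𝒪[K] (Fin 3 → K) // IsVertex σ ϖ ((StdForm.antidiagonal 3).over K) M}}
    (hvu : v = latticeGraphIso σ ϖ ((StdForm.antidiagonal 3).over K) u ⟨stdLattice K 3, 0, isSelfDualLattice_stdLattice_three_of_v hϖ⟩)
    (hv : IsSelfDualLattice σ ϖ ((StdForm.antidiagonal 3).over K) v.1)
    (hvR : v.1.map ((Matrix.toLin' (((γ : GL (Fin 3) K) : Matrix (Fin 3) (Fin 3) K) - 1)).restrictScalars 𝒪[K]) ≤ scaleLattice (ϖ ^ d₀) v.1)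
    (hlam : Valued.v (pairing σ ((StdForm.antidiagonal 3).over K) ((A : Matrix (Fin 3) (Fin 3) K) *ᵥ Pi.single i₀ 1) (((u : GL (Fin 3) K) : Matrix (Fin 3) (Fin 3) K) *ᵥ Pi.single 0 1)) < 1)
    (hmu : Valued.v (pairing σ ((StdForm.antidiagonal 3).over K) (ϖ ^ s' • ((A : Matrix (Fin 3) (Fin 3) K) *ᵥ Pi.single k 1)) (((u : GL (Fin 3) K) : Matrix (Fin 3) (Fin 3) K) *ᵥ Pi.single 0 1)) < 1)
    (Y₀ : Matrix (Fin 3) (Fin 3) 𝒪[K])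
    (hY₀ : ∀ a b, ((Y₀ a b : 𝒪[K]) : K) = (ϖ ^ d₀)⁻¹ * ((((u⁻¹ * γ * u : unitaryGroupOfForm σ ((StdForm.antidiagonal 3).over K)) : GL (Fin 3) K) : Matrix (Fin 3) (Fin 3) K) - 1) a b) :
    ∃ c t l : 𝓀[K], c ≠ 0 ∧
      (∀ x : Fin 3 → 𝓀[K], 2 * x 0 * x 2 + x 1 ^ 2 = 0 →
        x ⬝ᵥ ((((StdForm.antidiagonal 3).over 𝓀[K]) * Y₀.map (IsLocalRing.residue 𝒪[K])) *ᵥ x) = c * (x 1 + t * x 2) ^ 2 + l * x 2 ^ 2) ∧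
      (l = 0 ↔ ϖ ^ (s' - 1) • ((A : Matrix (Fin 3) (Fin 3) K) *ᵥ Pi.single k 1) ∈ v.1) ∧
      (∀ CO : 𝒪[K], (CO : K) = (ϖ ^ d₀)⁻¹ * (s i₀ - s j) * (d i₀ * (-(Matrix.diagonal d).det)⁻¹) →
        ∃ z : 𝓀[K], z ≠ 0 ∧ c = IsLocalRing.residue 𝒪[K] CO * z ^ 2) ∧
      (∀ BO : 𝒪[K], (BO : K) = (-1) ^ (s' + 1) * ((ϖ ^ d₀)⁻¹ * (s i₀ - s j)) * ((ϖ ^ (d₀ + 2 * s'))⁻¹ * (s k - s j)) * (d i₀ * d k) → l ≠ 0 →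
        ∃ z : 𝓀[K], z ≠ 0 ∧ -(l * c) = IsLocalRing.residue 𝒪[K] BO * z ^ 2) := by
  have hϖ0 : ϖ ≠ 0 := fun h0 => by rw [h0, map_zero] at hϖ; exact WithZero.coe_ne_zero hϖ.symm
  have hvϖ0 : Valued.v ϖ ≠ 0 := (Valuation.ne_zero_iff _).2 hϖ0
  have hϖd : (ϖ ^ d₀ : K) ≠ 0 := pow_ne_zero _ hϖ0
  have hϖ1 : Valued.v ϖ < 1 := by rw [hϖ, ← WithZero.exp_zero]; exact WithZero.exp_lt_exp.2 (by norm_num)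
  have hlt1 : ∀ z : K, Valued.v z < 1 ↔ Valued.v z ≤ Valued.v ϖ := fun z => by rw [hϖ]; exact v_lt_one_iff z
  -- the unit constants of the eigenframe
  have hdet : -(Matrix.diagonal d).det ≠ 0 := by
    rw [neg_ne_zero, Matrix.det_diagonal]; exact Finset.prod_ne_zero_iff.2 fun i _ h0 => by have := hd i; rw [h0, map_zero] at this; exact zero_ne_one this
  have hd0 : ∀ i, d i ≠ 0 := fun i h0 => by have := hd i; rw [h0, map_zero] at this; exact zero_ne_one this
  have hκ0 : (-(Matrix.diagonal d).det)⁻¹ ≠ 0 := inv_ne_zero hdet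
  have hκv : Valued.v (-(Matrix.diagonal d).det)⁻¹ = 1 := v_inv_neg_det_diagonal_eq_one hd
  have hκσ : σ (-(Matrix.diagonal d).det)⁻¹ = (-(Matrix.diagonal d).det)⁻¹ := by
    rw [map_inv₀, map_neg, Matrix.det_diagonal, map_prod]
    simp_rw [hdσ]
  have hσs' : (σ ϖ * ϖ) ^ s' = (-1) ^ s' * ϖ ^ (2 * s') := by rw [hσϖ, show -ϖ * ϖ = (-1) * ϖ ^ 2 by ring, mul_pow, ← pow_mul]
  have hm1 : ((-1 : K) ^ s') ≠ 0 := pow_ne_zero _ (neg_ne_zero.2 one_ne_zero)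
  -- the Gram matrix of the eigenframe: `⟨u_a, u_b⟩ = κ₀·diag(d)_{ab}`
  have hgram : ∀ a b : Fin 3, pairing σ ((StdForm.antidiagonal 3).over K) ((A : Matrix (Fin 3) (Fin 3) K) *ᵥ Pi.single a 1) ((A : Matrix (Fin 3) (Fin 3) K) *ᵥ Pi.single b 1) = (-(Matrix.diagonal d).det)⁻¹ * Matrix.diagonal d a b := by
    intro a b
    rw [pairing_mulVec_mulVec, pairing_single_single]
    have h := congrFun (congrFun hdA a) b
    rw [Matrix.smul_apply, smul_eq_mul] at h
    rw [h, ← mul_assoc, inv_mul_cancel₀ hdet, one_mul]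
  -- the frame `u`: `v = latt u`, `u⁻¹u = 1`, unitarity of the pairing
  have hv1 : v.1 = latt ((u : GL (Fin 3) K) : Matrix (Fin 3) (Fin 3) K) := by rw [hvu, latticeGraphIso_apply_val]; rfl
  have hUI : (((u⁻¹ : unitaryGroupOfForm σ ((StdForm.antidiagonal 3).over K)) : GL (Fin 3) K) : Matrix (Fin 3) (Fin 3) K) = ((u : GL (Fin 3) K) : Matrix (Fin 3) (Fin 3) K)⁻¹ := by rw [Subgroup.coe_inv, Matrix.coe_units_inv]
  have hUdet : IsUnit (((u : GL (Fin 3) K) : Matrix (Fin 3) (Fin 3) K)).det := Matrix.isUnits_det_units _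
  have hUIU : ∀ x : Fin 3 → K, (((u⁻¹ : unitaryGroupOfForm σ ((StdForm.antidiagonal 3).over K)) : GL (Fin 3) K) : Matrix (Fin 3) (Fin 3) K) *ᵥ (((u : GL (Fin 3) K) : Matrix (Fin 3) (Fin 3) K) *ᵥ x) = x := fun x => by
    rw [Matrix.mulVec_mulVec, hUI, Matrix.nonsing_inv_mul _ hUdet, Matrix.one_mulVec]
  have hUUI : ∀ x : Fin 3 → K, ((u : GL (Fin 3) K) : Matrix (Fin 3) (Fin 3) K) *ᵥ ((((u⁻¹ : unitaryGroupOfForm σ ((StdForm.antidiagonal 3).over K)) : GL (Fin 3) K) : Matrix (Fin 3) (Fin 3) K) *ᵥ x) = x := fun x => by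
    rw [Matrix.mulVec_mulVec, hUI, Matrix.mul_nonsing_inv _ hUdet, Matrix.one_mulVec]
  have hinvU : ∀ y z : Fin 3 → K, pairing σ ((StdForm.antidiagonal 3).over K) ((((u⁻¹ : unitaryGroupOfForm σ ((StdForm.antidiagonal 3).over K)) : GL (Fin 3) K) : Matrix (Fin 3) (Fin 3) K) *ᵥ y) ((((u⁻¹ : unitaryGroupOfForm σ ((StdForm.antidiagonal 3).over K)) : GL (Fin 3) K) : Matrix (Fin 3) (Fin 3) K) *ᵥ z) = pairing σ ((StdForm.antidiagonal 3).over K) y z :=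
    fun y z => pairing_mulVec_mulVec_of_mem_unitary (u⁻¹).2 y z
  have hinvU' : ∀ y z : Fin 3 → K, pairing σ ((StdForm.antidiagonal 3).over K) (((u : GL (Fin 3) K) : Matrix (Fin 3) (Fin 3) K) *ᵥ y) (((u : GL (Fin 3) K) : Matrix (Fin 3) (Fin 3) K) *ᵥ z) = pairing σ ((StdForm.antidiagonal 3).over K) y z :=
    fun y z => pairing_mulVec_mulVec_of_mem_unitary u.2 y z
  -- the two integral vectors `w = u⁻¹u_{i₀}`, `m = u⁻¹ϖ^{s'}u_k` (★ REGION CRITERION)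
  obtain ⟨hui₀, huk⟩ := (map_sub_one_le_scaleLattice_iff_mem_and_mem_of_isSelfDualLattice hσ hvσ hϖ A hd hdA s hγA i₀ he hiso hgap hv hk).1 hvR
  have hwint : ∀ i, Valued.v (((((u⁻¹ : unitaryGroupOfForm σ ((StdForm.antidiagonal 3).over K)) : GL (Fin 3) K) : Matrix (Fin 3) (Fin 3) K) *ᵥ ((A : Matrix (Fin 3) (Fin 3) K) *ᵥ Pi.single i₀ 1)) i) ≤ 1 := by
    have h := (mem_latt_iff_of_isUnit hUdet _).1 (hv1 ▸ hui₀)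
    rw [← hUI] at h
    exact h
  have hmint : ∀ i, Valued.v (((((u⁻¹ : unitaryGroupOfForm σ ((StdForm.antidiagonal 3).over K)) : GL (Fin 3) K) : Matrix (Fin 3) (Fin 3) K) *ᵥ (ϖ ^ s' • ((A : Matrix (Fin 3) (Fin 3) K) *ᵥ Pi.single k 1))) i) ≤ 1 := by
    have h := (mem_latt_iff_of_isUnit hUdet _).1 (hv1 ▸ huk)
    rw [← hUI] at h
    exact h
  set w₀ : Fin 3 → 𝒪[K] := fun i => ⟨((((u⁻¹ : unitaryGroupOfForm σ ((StdForm.antidiagonal 3).over K)) : GL (Fin 3) K) : Matrix (Fin 3) (Fin 3) K) *ᵥ ((A : Matrix (Fin 3) (Fin 3) K) *ᵥ Pi.single i₀ 1)) i, hwint i⟩ with hw₀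
  set m₀ : Fin 3 → 𝒪[K] := fun i => ⟨((((u⁻¹ : unitaryGroupOfForm σ ((StdForm.antidiagonal 3).over K)) : GL (Fin 3) K) : Matrix (Fin 3) (Fin 3) K) *ᵥ (ϖ ^ s' • ((A : Matrix (Fin 3) (Fin 3) K) *ᵥ Pi.single k 1))) i, hmint i⟩ with hm₀
  have hw₀c : (fun i => (w₀ i : K)) = ((((u⁻¹ : unitaryGroupOfForm σ ((StdForm.antidiagonal 3).over K)) : GL (Fin 3) K) : Matrix (Fin 3) (Fin 3) K) *ᵥ ((A : Matrix (Fin 3) (Fin 3) K) *ᵥ Pi.single i₀ 1)) := rfl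
  have hm₀c : (fun i => (m₀ i : K)) = ((((u⁻¹ : unitaryGroupOfForm σ ((StdForm.antidiagonal 3).over K)) : GL (Fin 3) K) : Matrix (Fin 3) (Fin 3) K) *ᵥ (ϖ ^ s' • ((A : Matrix (Fin 3) (Fin 3) K) *ᵥ Pi.single k 1))) := rfl
  -- residues of `w`, `m`: adaptation and (an)isotropy
  have hrev0 : Fin.rev (0 : Fin 3) = 2 := rfl
  have hrev1 : Fin.rev (1 : Fin 3) = 1 := rfl
  have hrev2 : Fin.rev (2 : Fin 3) = 0 := rfl
  have hpair_e0 : ∀ y : Fin 3 → K, pairing σ ((StdForm.antidiagonal 3).over K) y (Pi.single 0 1) = σ (y 2) := fun y => by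
    rw [pairing_antidiagonal, B₀_apply, Fin.sum_univ_three, hrev0, hrev1, hrev2]
    simp
  have hw2 : IsLocalRing.residue 𝒪[K] (w₀ 2) = 0 := by
    rw [residue_eq_zero_iff_v_lt_one]
    have h := hlam
    rw [← hinvU, hUIU, hpair_e0, hvσ] at h
    exact h
  have hm2 : IsLocalRing.residue 𝒪[K] (m₀ 2) = 0 := by
    rw [residue_eq_zero_iff_v_lt_one]
    have h := hmu
    rw [← hinvU, hUIU, hpair_e0, hvσ] at h
    exact h
  obtain ⟨nw, hnw, hnwres⟩ := exists_integer_pairing_and_residue_eq hvσ hres w₀ w₀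
  have hw1 : IsLocalRing.residue 𝒪[K] (w₀ 1) ≠ 0 := by
    have hv1' : Valued.v (nw : K) = 1 := by
      rw [hnw, hw₀c, hinvU, hgram, Matrix.diagonal_apply_eq, map_mul, hκv, hd, one_mul]
    have h := residue_ne_zero_of_v_eq_one _ hv1'
    rw [hnwres, hw2, mul_zero, zero_mul, zero_add, add_zero] at h
    exact fun h0 => h (by rw [h0, mul_zero])
  obtain ⟨nm, hnm, hnmres⟩ := exists_integer_pairing_and_residue_eq hvσ hres m₀ m₀
  have hm1' : IsLocalRing.residue 𝒪[K] (m₀ 1) = 0 := by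
    have hmm : pairing σ ((StdForm.antidiagonal 3).over K) (ϖ ^ s' • ((A : Matrix (Fin 3) (Fin 3) K) *ᵥ Pi.single k 1)) (ϖ ^ s' • ((A : Matrix (Fin 3) (Fin 3) K) *ᵥ Pi.single k 1)) =
        σ (ϖ ^ s') * (ϖ ^ s' * ((-(Matrix.diagonal d).det)⁻¹ * Matrix.diagonal d k k)) := by
      rw [LinearMap.map_smulₛₗ₂, map_smul, smul_eq_mul, smul_eq_mul, hgram]
    have hlt : Valued.v (nm : K) < 1 := by
      rw [hnm, hm₀c, hinvU, hmm, Matrix.diagonal_apply_eq, map_mul, map_mul, map_mul, hvσ, hκv, hd, mul_one, mul_one, map_pow]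
      calc Valued.v ϖ ^ s' * Valued.v ϖ ^ s' < 1 * 1 := by
            exact mul_lt_mul'' (pow_lt_one₀ zero_le hϖ1 (by omega)) (pow_lt_one₀ zero_le hϖ1 (by omega)) zero_le zero_le
        _ = 1 := one_mul 1
    have h := (residue_eq_zero_iff_v_lt_one nm).2 hlt
    rw [hnmres, hm2, mul_zero, zero_mul, zero_add, add_zero] at h
    exact pow_eq_zero_iff (n := 2) (by norm_num) |>.1 (by rw [pow_two]; exact h)
  -- the two shape coefficients `a = ϖ^{-d₀}α`, `b = ϖ^{-d₀}β` (units)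
  have hαv := v_shapeCoeff_i₀_eq hvσ hd s hj hiso
  have hβv := v_shapeCoeff_k_eq hvσ hϖ hd s hj hk hjk hgap
  have hav : Valued.v ((ϖ ^ d₀)⁻¹ * ((s i₀ - s j) / (σ (-(Matrix.diagonal d).det)⁻¹ * σ (d i₀)))) = 1 := by
    rw [map_mul, hαv, map_inv₀, map_pow, inv_mul_cancel₀ (pow_ne_zero _ hvϖ0)]
  have hbv : Valued.v ((ϖ ^ d₀)⁻¹ * ((s k - s j) / ((σ ϖ * ϖ) ^ s' * σ (-(Matrix.diagonal d).det)⁻¹ * σ (d k)))) = 1 := by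
    rw [map_mul, hβv, map_inv₀, map_pow, inv_mul_cancel₀ (pow_ne_zero _ hvϖ0)]
  set aO : 𝒪[K] := ⟨(ϖ ^ d₀)⁻¹ * ((s i₀ - s j) / (σ (-(Matrix.diagonal d).det)⁻¹ * σ (d i₀))), le_of_eq hav⟩ with haO
  set bO : 𝒪[K] := ⟨(ϖ ^ d₀)⁻¹ * ((s k - s j) / ((σ ϖ * ϖ) ^ s' * σ (-(Matrix.diagonal d).det)⁻¹ * σ (d k))), le_of_eq hbv⟩ with hbO
  have ha0 : IsLocalRing.residue 𝒪[K] aO ≠ 0 := residue_ne_zero_of_v_eq_one _ hav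
  have hb0 : IsLocalRing.residue 𝒪[K] bO ≠ 0 := residue_ne_zero_of_v_eq_one _ hbv
  have hej : Valued.v ((ϖ ^ d₀)⁻¹ * (s j - 1)) ≤ 1 := by
    rw [map_mul, map_inv₀, map_pow]
    calc (Valued.v ϖ ^ d₀)⁻¹ * Valued.v (s j - 1) ≤ (Valued.v ϖ ^ d₀)⁻¹ * Valued.v ϖ ^ d₀ := mul_le_mul' le_rfl (he j)
      _ = 1 := inv_mul_cancel₀ (pow_ne_zero _ hvϖ0)
  set eO : 𝒪[K] := ⟨(ϖ ^ d₀)⁻¹ * (s j - 1), hej⟩ with heO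
  -- THE WITNESSES
  refine ⟨IsLocalRing.residue 𝒪[K] aO * IsLocalRing.residue 𝒪[K] (w₀ 1) ^ 2, IsLocalRing.residue 𝒪[K] (w₀ 0) / IsLocalRing.residue 𝒪[K] (w₀ 1), IsLocalRing.residue 𝒪[K] bO * IsLocalRing.residue 𝒪[K] (m₀ 0) ^ 2,
    mul_ne_zero ha0 (pow_ne_zero _ hw1), fun x hx => ?_, ?_, fun CO hCO => ?_, fun BO hBO hl => ?_⟩
  · -- the value form on an isotropic residual vector
    obtain ⟨lift, hlift⟩ : ∃ lift : 𝓀[K] → 𝒪[K], ∀ a, IsLocalRing.residue 𝒪[K] (lift a) = a :=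
      ⟨Function.surjInv IsLocalRing.residue_surjective, Function.surjInv_eq IsLocalRing.residue_surjective⟩
    set x₀ : Fin 3 → 𝒪[K] := fun i => lift (x i) with hx₀
    have hxres : (fun i => IsLocalRing.residue 𝒪[K] (x₀ i)) = x := funext fun i => hlift (x i)
    obtain ⟨t, ht, htres⟩ := exists_integer_eq_test_and_residue_eq hvσ hres hϖ0 ((((u⁻¹ * γ * u : unitaryGroupOfForm σ ((StdForm.antidiagonal 3).over K)) : GL (Fin 3) K) : Matrix (Fin 3) (Fin 3) K) - 1) Y₀ hY₀ x₀
    rw [hxres] at htres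
    rw [← htres]
    -- the three integral pairings and their residues
    obtain ⟨nO, hnO, hnOres⟩ := exists_integer_pairing_and_residue_eq hvσ hres x₀ x₀
    obtain ⟨pO, hpO, hpOres⟩ := exists_integer_pairing_and_residue_eq hvσ hres w₀ x₀
    obtain ⟨qO, hqO, hqOres⟩ := exists_integer_pairing_and_residue_eq hvσ hres m₀ x₀
    have hlift' : ∀ i, IsLocalRing.residue 𝒪[K] (x₀ i) = x i := fun i => hlift (x i)
    simp only [hlift'] at hnOres hpOres hqOres
    set pOσ : 𝒪[K] := ⟨σ (pO : K), map_coe_mem_integer hvσ pO⟩ with hpOσ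
    set qOσ : 𝒪[K] := ⟨σ (qO : K), map_coe_mem_integer hvσ qO⟩ with hqOσ
    have hpOσres : IsLocalRing.residue 𝒪[K] pOσ = IsLocalRing.residue 𝒪[K] pO := residue_map_sigma_eq hvσ hres pO
    have hqOσres : IsLocalRing.residue 𝒪[K] qOσ = IsLocalRing.residue 𝒪[K] qO := residue_map_sigma_eq hvσ hres qO
    -- the K-identity: the test value through ★ §7 transported by `u`
    have hconj : (((u⁻¹ * γ * u : unitaryGroupOfForm σ ((StdForm.antidiagonal 3).over K)) : GL (Fin 3) K) : Matrix (Fin 3) (Fin 3) K) = (((u⁻¹ : unitaryGroupOfForm σ ((StdForm.antidiagonal 3).over K)) : GL (Fin 3) K) : Matrix (Fin 3) (Fin 3) K) * ((γ : GL (Fin 3) K) : Matrix (Fin 3) (Fin 3) K) * ((u : GL (Fin 3) K) : Matrix (Fin 3) (Fin 3) K) := by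
      rw [Subgroup.coe_mul, Subgroup.coe_mul, Units.val_mul, Units.val_mul]
    have hMx : ((((u⁻¹ * γ * u : unitaryGroupOfForm σ ((StdForm.antidiagonal 3).over K)) : GL (Fin 3) K) : Matrix (Fin 3) (Fin 3) K) - 1) *ᵥ (fun i => (x₀ i : K)) = (((u⁻¹ : unitaryGroupOfForm σ ((StdForm.antidiagonal 3).over K)) : GL (Fin 3) K) : Matrix (Fin 3) (Fin 3) K) *ᵥ ((((γ : GL (Fin 3) K) : Matrix (Fin 3) (Fin 3) K) - 1) *ᵥ (((u : GL (Fin 3) K) : Matrix (Fin 3) (Fin 3) K) *ᵥ fun i => (x₀ i : K))) := by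
      rw [Matrix.sub_mulVec, Matrix.one_mulVec, hconj, ← Matrix.mulVec_mulVec, ← Matrix.mulVec_mulVec, Matrix.sub_mulVec, Matrix.one_mulVec, Matrix.mulVec_sub, hUIU]
    have hshape := pairing_sub_one_mulVec_sub_eq_norm_add_norm hσ hϖ0 A hd0 hdA s hγA hj hk hjk s' (((u : GL (Fin 3) K) : Matrix (Fin 3) (Fin 3) K) *ᵥ fun i => (x₀ i : K))
    have hP : pairing σ ((StdForm.antidiagonal 3).over K) ((A : Matrix (Fin 3) (Fin 3) K) *ᵥ Pi.single i₀ 1) (((u : GL (Fin 3) K) : Matrix (Fin 3) (Fin 3) K) *ᵥ fun i => (x₀ i : K)) = (pO : K) := by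
      rw [hpO, hw₀c, ← hinvU, hUIU]
    have hQ : pairing σ ((StdForm.antidiagonal 3).over K) (ϖ ^ s' • ((A : Matrix (Fin 3) (Fin 3) K) *ᵥ Pi.single k 1)) (((u : GL (Fin 3) K) : Matrix (Fin 3) (Fin 3) K) *ᵥ fun i => (x₀ i : K)) = (qO : K) := by
      rw [hqO, hm₀c, ← hinvU, hUIU]
    have hN : pairing σ ((StdForm.antidiagonal 3).over K) (((u : GL (Fin 3) K) : Matrix (Fin 3) (Fin 3) K) *ᵥ fun i => (x₀ i : K)) (((u : GL (Fin 3) K) : Matrix (Fin 3) (Fin 3) K) *ᵥ fun i => (x₀ i : K)) = (nO : K) := by rw [hnO, hinvU']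
    rw [hP, hQ, hN] at hshape
    have hT : (t : K) = ((eO * nO + aO * (pO * pOσ) + bO * (qO * qOσ) : 𝒪[K]) : K) := by
      rw [ht, ← pairing_antidiagonal, hMx, ← hinvU' (fun i => (x₀ i : K)), hUUI, eq_add_of_sub_eq hshape]
      push_cast
      rw [heO, haO, hbO, hpOσ, hqOσ]
      ring
    rw [Subtype.ext hT]
    simp only [map_add, map_mul, hnOres, hpOres, hqOres, hpOσres, hqOσres, hw2, hm2, hm1', zero_mul, add_zero]
    have hn0 : x 0 * x 2 + x 1 * x 1 + x 2 * x 0 = 0 := by linear_combination hx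
    rw [hn0, mul_zero, zero_add]
    field_simp
    ring
  · -- `l = 0 ↔ ϖ^{s'-1}u_k ∈ v`
    rw [mul_eq_zero, or_iff_right hb0, pow_eq_zero_iff (two_ne_zero), hv1, mem_latt_iff_of_isUnit hUdet, ← hUI, mem_stdLattice]
    have hms : ((((u⁻¹ : unitaryGroupOfForm σ ((StdForm.antidiagonal 3).over K)) : GL (Fin 3) K) : Matrix (Fin 3) (Fin 3) K) *ᵥ (ϖ ^ s' • ((A : Matrix (Fin 3) (Fin 3) K) *ᵥ Pi.single k 1))) = ϖ • ((((u⁻¹ : unitaryGroupOfForm σ ((StdForm.antidiagonal 3).over K)) : GL (Fin 3) K) : Matrix (Fin 3) (Fin 3) K) *ᵥ (ϖ ^ (s' - 1) • ((A : Matrix (Fin 3) (Fin 3) K) *ᵥ Pi.single k 1))) := by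
      rw [Matrix.mulVec_smul, Matrix.mulVec_smul, smul_smul, ← pow_succ', Nat.sub_add_cancel hs']
    have hcoord : ∀ i, ((((u⁻¹ : unitaryGroupOfForm σ ((StdForm.antidiagonal 3).over K)) : GL (Fin 3) K) : Matrix (Fin 3) (Fin 3) K) *ᵥ (ϖ ^ (s' - 1) • ((A : Matrix (Fin 3) (Fin 3) K) *ᵥ Pi.single k 1))) i = ϖ⁻¹ * ((((u⁻¹ : unitaryGroupOfForm σ ((StdForm.antidiagonal 3).over K)) : GL (Fin 3) K) : Matrix (Fin 3) (Fin 3) K) *ᵥ (ϖ ^ s' • ((A : Matrix (Fin 3) (Fin 3) K) *ᵥ Pi.single k 1))) i := fun i => by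
      rw [hms, Pi.smul_apply, smul_eq_mul, inv_mul_cancel_left₀ hϖ0]
    have hiff : ∀ i, Valued.v (((((u⁻¹ : unitaryGroupOfForm σ ((StdForm.antidiagonal 3).over K)) : GL (Fin 3) K) : Matrix (Fin 3) (Fin 3) K) *ᵥ (ϖ ^ (s' - 1) • ((A : Matrix (Fin 3) (Fin 3) K) *ᵥ Pi.single k 1))) i) ≤ 1 ↔ IsLocalRing.residue 𝒪[K] (m₀ i) = 0 := fun i => by
      rw [hcoord, residue_eq_zero_iff_v_lt_one, hlt1, map_mul, map_inv₀]
      change (Valued.v ϖ)⁻¹ * Valued.v (((((u⁻¹ : unitaryGroupOfForm σ ((StdForm.antidiagonal 3).over K)) : GL (Fin 3) K) : Matrix (Fin 3) (Fin 3) K) *ᵥ (ϖ ^ s' • ((A : Matrix (Fin 3) (Fin 3) K) *ᵥ Pi.single k 1))) i) ≤ 1 ↔ Valued.v (((((u⁻¹ : unitaryGroupOfForm σ ((StdForm.antidiagonal 3).over K)) : GL (Fin 3) K) : Matrix (Fin 3) (Fin 3) K) *ᵥ (ϖ ^ s' • ((A : Matrix (Fin 3) (Fin 3) K) *ᵥ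 Pi.single k 1))) i) ≤ Valued.v ϖ
      rw [inv_mul_le_iff₀ (zero_lt_iff.2 hvϖ0), mul_one]
    simp only [hiff]
    constructor
    · intro h0 i
      fin_cases i
      · exact h0
      · exact hm1'
      · exact hm2
    · intro h; exact h 0
  · -- class pin of `c`: `a = C·(κ₀d_{i₀})⁻²`
    have hgv : Valued.v (((-(Matrix.diagonal d).det)⁻¹ * d i₀)⁻¹) ≤ 1 := by rw [map_inv₀, map_mul, hκv, hd, one_mul, inv_one]
    set gO : 𝒪[K] := ⟨((-(Matrix.diagonal d).det)⁻¹ * d i₀)⁻¹, hgv⟩ with hgO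
    have hg0 : IsLocalRing.residue 𝒪[K] gO ≠ 0 := residue_ne_zero_of_v_eq_one _ (by rw [hgO]; push_cast; rw [map_inv₀, map_mul, hκv, hd, one_mul, inv_one])
    have haCO : aO = CO * gO ^ 2 := Subtype.ext (by
      rw [haO]; push_cast; rw [hCO, hgO, hκσ, hdσ]; push_cast; field_simp)
    refine ⟨IsLocalRing.residue 𝒪[K] gO * IsLocalRing.residue 𝒪[K] (w₀ 1), mul_ne_zero hg0 hw1, ?_⟩
    rw [haCO, map_mul, map_pow]; ring
  · -- class pin of `-l·c` at an END vertex: `-a·b = B·(κ₀d_{i₀}d_k)⁻²`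
    have hm00 : IsLocalRing.residue 𝒪[K] (m₀ 0) ≠ 0 := fun h0 => hl (by rw [h0]; ring)
    have hhv : Valued.v (((-(Matrix.diagonal d).det)⁻¹ * d i₀ * d k)⁻¹) ≤ 1 := by rw [map_inv₀, map_mul, map_mul, hκv, hd, hd, one_mul, one_mul, inv_one]
    set hO : 𝒪[K] := ⟨((-(Matrix.diagonal d).det)⁻¹ * d i₀ * d k)⁻¹, hhv⟩ with hhO
    have hh0 : IsLocalRing.residue 𝒪[K] hO ≠ 0 := residue_ne_zero_of_v_eq_one _ (by rw [hhO]; push_cast; rw [map_inv₀, map_mul, map_mul, hκv, hd, hd, one_mul, one_mul, inv_one])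
    have habBO : -(aO * bO) = BO * hO ^ 2 := Subtype.ext (by
      rw [haO, hbO, hhO]; push_cast; rw [hBO, hσs', hκσ, hdσ, hdσ, pow_add, pow_mul, pow_succ]
      rcases neg_one_pow_eq_or K s' with h1 | h1
      · rw [h1]; field_simp; ring
      · rw [h1]; field_simp; ring)
    refine ⟨IsLocalRing.residue 𝒪[K] hO * IsLocalRing.residue 𝒪[K] (m₀ 0) * IsLocalRing.residue 𝒪[K] (w₀ 1), mul_ne_zero (mul_ne_zero hh0 hm00) hw1, ?_⟩
    have h := congrArg (IsLocalRing.residue 𝒪[K]) habBO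
    rw [map_neg, map_mul, map_mul, map_pow] at h
    linear_combination (IsLocalRing.residue 𝒪[K] (m₀ 0)) ^ 2 * (IsLocalRing.residue 𝒪[K] (w₀ 1)) ^ 2 * h

end Literature.NumberTheory.Automorphic.UnitaryLatticeTree

end
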